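import Mathlib
import Literature.Analysis.FluidPDE.GaussianVortexPlanar
import Literature.Analysis.FluidPDE.GaussianVortexPlanarProofs
import Literature.Analysis.FluidPDE.BiotSavart2DSymmetry
import Summits.AnomalousDissipation.AnomalousDissipation.Theorems.MarginalStabilityChainStretchedVortexRowsStubCoreRotationLocalSkew
import Summits.AnomalousDissipation.AnomalousDissipation.Theorems.MarginalStabilityChainStretchedVortexRowsStubBiotSavartFarField
import Summits.AnomalousDissipation.AnomalousDissipation.Theorems.MarginalStabilityChainStretchedVortexRowsStubLamBPairingDtheta
import Summits.AnomalousDissipation.AnomalousDissipation.Theorems.MarginalStabilityChainStretchedVortexRowsStubCircAvgTools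
import Summits.AnomalousDissipation.AnomalousDissipation.Theorems.MarginalStabilityChainStretchedVortexRowsStubCircAvgPolar
import Summits.AnomalousDissipation.AnomalousDissipation.Theorems.MarginalStabilityChainStretchedVortexRowsStubCircAvgWirtinger
import Summits.AnomalousDissipation.AnomalousDissipation.Theorems.MarginalStabilityChainStretchedVortexRowsStubRadialFluxZero
import HarnessLib

/-!
# Tools for the helper `lamB_pairing_w_bound` toward stub `stub_coreInverse` of the line
# `braid-closed-large-circulation-gluing` (crux stmt-AnomalousDissipation-3009, `MarginalStabilityChain.StretchedVortexRows`):
# the potential term of the background pairing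

After the transport identity `∫ G⁻¹ w ⟪K∗w_B, ∇w⟫ = −¼ ∫ G u² (ξ·K∗w_B)` (`lamB_transport_pairing_identity`, `w = Gu`),
the transport half of `⟨Λ_B w, w⟩_{L²(G⁻¹)}` is a POTENTIAL term. Here (`lamB_w_potential_piece`):
  `|∫ G u² ⟪ξ, K∗w_B⟫| ≤ c(k, C_B) (∫ G u²)^{1/2} (∫ G Ω (∂_θu)²)^{1/2}`
for even `u ∈ C¹` with `u, Du` bounded and `|w_B| ≤ C_B(1+|ξ|)^k G`, where `Ω = (8π)⁻¹φ(|ξ|²/4)` and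
`∂_θu = Du[ξ^⊥]`. Proof: split `u² = u₀² + (u − u₀)(u + u₀)` with the circular mean `u₀` of `u`;
the radial block `∫ G u₀² ⟪ξ, K∗w_B⟫` vanishes (no flux of a divergence-free field through circles, landed
`integral_gauss_radial_mul_inner_id_biotSavart2D_eq_zero`), and the remainder is bounded by Cauchy–Schwarz with
`[8π(C_FC_B)² G(u+u₀)²]·[GΩ(u−u₀)²]`, using the far field `|ξ·K∗w_B(ξ)| ≤ C_FC_B/(1+|ξ|)`
(`biotSavart2D_farField`), `1 ≤ 8π(1+|ξ|)²Ω`, the contraction `∫Gu₀² ≤ ∫Gu²` and Wirtinger's inequality on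
circles for even functions `∫GΩ(u−u₀)² ≤ ¼∫GΩ(∂_θu)²` (`circAvg_wirtinger_even`).

References: Th. Gallay, C. E. Wayne, Comm. Math. Phys. 255 (2005) §4.1; elementary (folklore).
-/

set_option linter.dupNamespace false

noncomputable section

open scoped RealInnerProductSpace Topology
open MeasureTheory WithLp Function Metric Filter Set

namespace Summit.AnomalousDissipation.AnomalousDissipation.Theorems.MarginalStabilityChainStretchedVortexRows

open Literature.Analysis.FluidPDE

/-- **The potential term of the background pairing**: there is `c = c(k, C_B) ≥ 0` with
`|∫ G u² ⟪ξ, K∗w_B⟫| ≤ c (∫Gu²)^{1/2} (∫GΩ(Du[ξ^⊥])²)^{1/2}` for even `u ∈ C¹` (`u, Du` bounded) and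
`|w_B| ≤ C_B(1+|ξ|)^kG` (the radial block vanishes; the rest is Cauchy–Schwarz + Wirtinger on circles). [folklore] -/
theorem lamB_w_potential_piece :
    ∀ (k : ℕ) (C_B : ℝ), ∃ c : ℝ, 0 ≤ c ∧ ∀ (wB u : EuclideanSpace ℝ (Fin 2) → ℝ), Continuous wB →
      (∀ ξ, |wB ξ| ≤ C_B * (1 + ‖ξ‖) ^ k * gaussVortexProfile ξ) →
      ContDiff ℝ 1 u → (∀ ξ, u (-ξ) = u ξ) → (∃ M : ℝ, ∀ ξ, |u ξ| ≤ M ∧ ‖fderiv ℝ u ξ‖ ≤ M) →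
      |∫ ξ, gaussVortexProfile ξ * u ξ ^ 2 * ⟪ξ, biotSavart2D wB ξ⟫| ≤
        c * Real.sqrt (∫ ξ, gaussVortexProfile ξ * u ξ ^ 2) *
          Real.sqrt (∫ ξ, gaussVortexProfile ξ * ((8 * Real.pi)⁻¹ * burgersPhi (‖ξ‖ ^ 2 / 4)) *
            (fderiv ℝ u ξ (perp ξ)) ^ 2) := by
  intro k C_B
  obtain ⟨C_F, hCF0, hCF⟩ := biotSavart2D_farField k
  refine ⟨Real.sqrt (32 * Real.pi * (C_F * C_B) ^ 2), Real.sqrt_nonneg _, ?_⟩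
  rintro wB u hwBc hwBb hu heven ⟨M, hM⟩
  have hGpos : ∀ ξ : EuclideanSpace ℝ (Fin 2), 0 < gaussVortexProfile ξ := gaussVortexProfile_pos
  have hGc : Continuous gaussVortexProfile := (contDiff_gaussVortexProfile (n := 0)).continuous
  have hΩc : Continuous fun ξ : EuclideanSpace ℝ (Fin 2) => (8 * Real.pi)⁻¹ * burgersPhi (‖ξ‖ ^ 2 / 4) :=
    continuous_const.mul ((contDiff_burgersPhi (n := 0)).continuous.comp ((continuous_norm.pow 2).div_const 4))
  have hΩ0 : ∀ ξ : EuclideanSpace ℝ (Fin 2), 0 < (8 * Real.pi)⁻¹ * burgersPhi (‖ξ‖ ^ 2 / 4) := fun ξ =>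
    mul_pos (by positivity) (burgersPhi_pos _)
  have hΩ1 : ∀ ξ : EuclideanSpace ℝ (Fin 2), (8 * Real.pi)⁻¹ * burgersPhi (‖ξ‖ ^ 2 / 4) ≤ (8 * Real.pi)⁻¹ :=
    fun ξ => mul_le_of_le_one_right (by positivity) (burgersPhi_le_one (by positivity))
  have hM0 : 0 ≤ M := (abs_nonneg _).trans (hM 0).1
  have hCB : 0 ≤ C_B := by
    have h0 := hwBb 0
    rw [norm_zero, add_zero, one_pow, mul_one] at h0
    nlinarith [abs_nonneg (wB 0), hGpos 0]
  have huc : Continuous u := hu.continuous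
  -- the circular mean `u₀` of `u`
  set u₀ : EuclideanSpace ℝ (Fin 2) → ℝ := fun ξ => (2 * Real.pi)⁻¹ * ∫ t in (0:ℝ)..2 * Real.pi,
    u (Real.cos t • ξ + Real.sin t • perp ξ) with hu₀
  have hu₀c : Continuous u₀ := continuous_circularMean hu₀ huc
  have hu₀b : ∀ ξ, |u₀ ξ| ≤ M := abs_circularMean_le hu₀ fun ξ => (hM ξ).1
  have hu₀rad : ∀ ξ η : EuclideanSpace ℝ (Fin 2), ‖ξ‖ = ‖η‖ → u₀ ξ = u₀ η := circularMean_radial hu₀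
  -- the background velocity `b = K∗w_B` and its radial component
  set b : EuclideanSpace ℝ (Fin 2) → EuclideanSpace ℝ (Fin 2) := biotSavart2D wB with hb
  have hbm : AEStronglyMeasurable b volume := (stronglyMeasurable_biotSavart2D hwBc.measurable).aestronglyMeasurable
  have hbr : ∀ ξ, |⟪ξ, b ξ⟫| * (1 + ‖ξ‖) ≤ C_F * C_B := fun ξ => by
    have h := (hCF C_B wB hwBc hwBb ξ).2
    rwa [le_div_iff₀ (by positivity)] at h
  have hbr' : ∀ ξ, |⟪ξ, b ξ⟫| ≤ C_F * C_B := fun ξ =>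
    (le_mul_of_one_le_right (abs_nonneg _) (by linarith [norm_nonneg ξ])).trans (hbr ξ)
  -- the radial block vanishes
  have hzero : ∫ ξ, gaussVortexProfile ξ * u₀ ξ ^ 2 * ⟪ξ, b ξ⟫ = 0 :=
    integral_gauss_radial_mul_inner_id_biotSavart2D_eq_zero k C_B (M ^ 2) wB (fun ξ => u₀ ξ ^ 2) hwBc hwBb
      (hu₀c.pow 2) (fun ξ η h => by show u₀ ξ ^ 2 = u₀ η ^ 2; rw [hu₀rad ξ η h]) fun ξ => by
        rw [abs_of_nonneg (sq_nonneg _), ← sq_abs]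
        exact pow_le_pow_left₀ (abs_nonneg _) (hu₀b ξ) 2
  have hzi : Integrable fun ξ => gaussVortexProfile ξ * u₀ ξ ^ 2 * ⟪ξ, b ξ⟫ := by
    refine ((integrable_one_add_norm_pow_mul_gaussVortexProfile 0).const_mul (M ^ 2 * (C_F * C_B))).mono'
      ((hGc.mul (hu₀c.pow 2)).aestronglyMeasurable.mul (continuous_id.aestronglyMeasurable.inner hbm))
      (Eventually.of_forall fun ξ => ?_)
    rw [Real.norm_eq_abs, abs_mul, abs_mul, abs_of_pos (hGpos ξ), abs_of_nonneg (sq_nonneg _), pow_zero, one_mul]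
    have hu2 : u₀ ξ ^ 2 ≤ M ^ 2 := by rw [← sq_abs]; exact pow_le_pow_left₀ (abs_nonneg _) (hu₀b ξ) 2
    have := mul_le_mul hu2 (hbr' ξ) (abs_nonneg _) (sq_nonneg M)
    nlinarith [(hGpos ξ).le, mul_nonneg (mul_nonneg (sq_nonneg M) (mul_nonneg hCF0.le hCB)) (hGpos ξ).le]
  -- the Gaussian `L²` quantities: `∫ G u²`, `∫ G u₀² ≤ ∫ G u²`, `∫ G (u + u₀)² ≤ 4 ∫ G u²`
  have hN0 : ∀ ξ, 0 ≤ gaussVortexProfile ξ * u ξ ^ 2 := fun ξ => mul_nonneg (hGpos ξ).le (sq_nonneg _)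
  have hNi : Integrable fun ξ => gaussVortexProfile ξ * u ξ ^ 2 := by
    refine integrable_of_le_one_add_norm_pow_mul_gauss (hGc.mul (huc.pow 2)) (A := M ^ 2) (N := 0) fun ξ => ?_
    rw [Real.norm_of_nonneg (hN0 ξ), pow_zero, one_mul, mul_comm]
    have hu2 : u ξ ^ 2 ≤ M ^ 2 := by rw [← sq_abs]; exact pow_le_pow_left₀ (abs_nonneg _) (hM ξ).1 2
    exact mul_le_mul_of_nonneg_right hu2 (hGpos ξ).le
  obtain ⟨hN₀i, hN₀le⟩ := integral_mul_circularMean_sq_le hu₀ huc (ρ := gaussVortexProfile) hGc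
    (fun ξ => (hGpos ξ).le) (fun ξ η h => by rw [gaussVortexProfile, gaussVortexProfile, h]) hNi
  have hP0 : ∀ ξ, 0 ≤ gaussVortexProfile ξ * (u ξ + u₀ ξ) ^ 2 := fun ξ => mul_nonneg (hGpos ξ).le (sq_nonneg _)
  have hPle : ∀ ξ, gaussVortexProfile ξ * (u ξ + u₀ ξ) ^ 2 ≤
      2 * (gaussVortexProfile ξ * u ξ ^ 2) + 2 * (gaussVortexProfile ξ * u₀ ξ ^ 2) := fun ξ => by
    nlinarith [mul_nonneg (hGpos ξ).le (sq_nonneg (u ξ - u₀ ξ))]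
  have hPi : Integrable fun ξ => gaussVortexProfile ξ * (u ξ + u₀ ξ) ^ 2 :=
    ((hNi.const_mul 2).add (hN₀i.const_mul 2)).mono' (hGc.mul ((huc.add hu₀c).pow 2)).aestronglyMeasurable
      (Eventually.of_forall fun ξ => by rw [Real.norm_of_nonneg (hP0 ξ)]; exact hPle ξ)
  have hPint : ∫ ξ, gaussVortexProfile ξ * (u ξ + u₀ ξ) ^ 2 ≤ 4 * ∫ ξ, gaussVortexProfile ξ * u ξ ^ 2 := by
    calc ∫ ξ, gaussVortexProfile ξ * (u ξ + u₀ ξ) ^ 2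
        ≤ ∫ ξ, (2 * (gaussVortexProfile ξ * u ξ ^ 2) + 2 * (gaussVortexProfile ξ * u₀ ξ ^ 2)) :=
          integral_mono hPi ((hNi.const_mul 2).add (hN₀i.const_mul 2)) hPle
      _ = 2 * (∫ ξ, gaussVortexProfile ξ * u ξ ^ 2) + 2 * ∫ ξ, gaussVortexProfile ξ * u₀ ξ ^ 2 := by
          rw [integral_add (hNi.const_mul 2) (hN₀i.const_mul 2), integral_const_mul, integral_const_mul]
      _ ≤ 4 * ∫ ξ, gaussVortexProfile ξ * u ξ ^ 2 := by linarith
  -- the angular quantity: `∫ GΩ(u − u₀)² ≤ ¼ ∫ GΩ(∂_θu)²`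
  have hQ0 : ∀ ξ, 0 ≤ gaussVortexProfile ξ * ((8 * Real.pi)⁻¹ * burgersPhi (‖ξ‖ ^ 2 / 4)) * (u ξ - u₀ ξ) ^ 2 :=
    fun ξ => mul_nonneg (mul_nonneg (hGpos ξ).le (hΩ0 ξ).le) (sq_nonneg _)
  have hρi : Integrable fun ξ => gaussVortexProfile ξ * ((8 * Real.pi)⁻¹ * burgersPhi (‖ξ‖ ^ 2 / 4)) * u ξ ^ 2 := by
    refine (hNi.const_mul (8 * Real.pi)⁻¹).mono' ((hGc.mul hΩc).mul (huc.pow 2)).aestronglyMeasurable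
      (Eventually.of_forall fun ξ => ?_)
    rw [Real.norm_of_nonneg (mul_nonneg (mul_nonneg (hGpos ξ).le (hΩ0 ξ).le) (sq_nonneg _))]
    calc gaussVortexProfile ξ * ((8 * Real.pi)⁻¹ * burgersPhi (‖ξ‖ ^ 2 / 4)) * u ξ ^ 2
        ≤ gaussVortexProfile ξ * (8 * Real.pi)⁻¹ * u ξ ^ 2 :=
          mul_le_mul_of_nonneg_right (mul_le_mul_of_nonneg_left (hΩ1 ξ) (hGpos ξ).le) (sq_nonneg _)
      _ = (8 * Real.pi)⁻¹ * (gaussVortexProfile ξ * u ξ ^ 2) := by ring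
  obtain ⟨hQi, -⟩ := integral_mul_sub_circularMean_sq_le hu₀ huc
    (ρ := fun ξ => gaussVortexProfile ξ * ((8 * Real.pi)⁻¹ * burgersPhi (‖ξ‖ ^ 2 / 4))) (hGc.mul hΩc)
    (fun ξ => mul_nonneg (hGpos ξ).le (hΩ0 ξ).le)
    (fun ξ η h => by simp only [gaussVortexProfile, h]) hρi
  have hW : ∫ ξ, gaussVortexProfile ξ * ((8 * Real.pi)⁻¹ * burgersPhi (‖ξ‖ ^ 2 / 4)) * (u ξ - u₀ ξ) ^ 2 ≤
      1 / 4 * ∫ ξ, gaussVortexProfile ξ * ((8 * Real.pi)⁻¹ * burgersPhi (‖ξ‖ ^ 2 / 4)) *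
        (fderiv ℝ u ξ (perp ξ)) ^ 2 := circAvg_wirtinger_even u hu heven ⟨M, hM⟩
  have hA0 : 0 ≤ ∫ ξ, gaussVortexProfile ξ * ((8 * Real.pi)⁻¹ * burgersPhi (‖ξ‖ ^ 2 / 4)) *
      (fderiv ℝ u ξ (perp ξ)) ^ 2 :=
    integral_nonneg fun ξ => mul_nonneg (mul_nonneg (hGpos ξ).le (hΩ0 ξ).le) (sq_nonneg _)
  -- Cauchy–Schwarz for the non-radial remainder `r = G(u − u₀)(u + u₀)⟪ξ, b⟫`
  have hrm : AEStronglyMeasurable (fun ξ => gaussVortexProfile ξ * (u ξ - u₀ ξ) * (u ξ + u₀ ξ) * ⟪ξ, b ξ⟫) volume :=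
    (((hGc.mul (huc.sub hu₀c)).mul (huc.add hu₀c)).aestronglyMeasurable).mul
      (continuous_id.aestronglyMeasurable.inner hbm)
  have hCS := integrable_and_abs_integral_le_of_sq_le_mul hrm (hPi.const_mul (8 * Real.pi * (C_F * C_B) ^ 2)) hQi
    (fun ξ => mul_nonneg (by positivity) (hP0 ξ)) hQ0 (fun ξ => by
      have h2 : ⟪ξ, b ξ⟫ ^ 2 * (1 + ‖ξ‖) ^ 2 ≤ (C_F * C_B) ^ 2 := by
        have := pow_le_pow_left₀ (by positivity) (hbr ξ) 2
        rwa [mul_pow, sq_abs] at this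
      have h3 : ⟪ξ, b ξ⟫ ^ 2 ≤ 8 * Real.pi * (C_F * C_B) ^ 2 * ((8 * Real.pi)⁻¹ * burgersPhi (‖ξ‖ ^ 2 / 4)) :=
        calc ⟪ξ, b ξ⟫ ^ 2
            ≤ ⟪ξ, b ξ⟫ ^ 2 * (8 * Real.pi * (1 + ‖ξ‖) ^ 2 * ((8 * Real.pi)⁻¹ * burgersPhi (‖ξ‖ ^ 2 / 4))) :=
              le_mul_of_one_le_right (sq_nonneg _) (one_le_mul_sq_mul_omegaWeight ξ)
          _ = 8 * Real.pi * (⟪ξ, b ξ⟫ ^ 2 * (1 + ‖ξ‖) ^ 2) * ((8 * Real.pi)⁻¹ * burgersPhi (‖ξ‖ ^ 2 / 4)) := by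
              ring
          _ ≤ 8 * Real.pi * (C_F * C_B) ^ 2 * ((8 * Real.pi)⁻¹ * burgersPhi (‖ξ‖ ^ 2 / 4)) :=
              mul_le_mul_of_nonneg_right (mul_le_mul_of_nonneg_left h2 (by positivity)) (hΩ0 ξ).le
      calc (gaussVortexProfile ξ * (u ξ - u₀ ξ) * (u ξ + u₀ ξ) * ⟪ξ, b ξ⟫) ^ 2
          = (gaussVortexProfile ξ * (u ξ - u₀ ξ) * (u ξ + u₀ ξ)) ^ 2 * ⟪ξ, b ξ⟫ ^ 2 := by ring
        _ ≤ (gaussVortexProfile ξ * (u ξ - u₀ ξ) * (u ξ + u₀ ξ)) ^ 2 *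
              (8 * Real.pi * (C_F * C_B) ^ 2 * ((8 * Real.pi)⁻¹ * burgersPhi (‖ξ‖ ^ 2 / 4))) :=
            mul_le_mul_of_nonneg_left h3 (sq_nonneg _)
        _ = 8 * Real.pi * (C_F * C_B) ^ 2 * (gaussVortexProfile ξ * (u ξ + u₀ ξ) ^ 2) *
              (gaussVortexProfile ξ * ((8 * Real.pi)⁻¹ * burgersPhi (‖ξ‖ ^ 2 / 4)) * (u ξ - u₀ ξ) ^ 2) := by
            ring)
  obtain ⟨hri, hrle⟩ := hCS
  rw [integral_const_mul] at hrle
  -- assemble: `G u² ⟪ξ, b⟫ = G u₀² ⟪ξ, b⟫ + r`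
  have hpt : ∀ ξ, gaussVortexProfile ξ * u ξ ^ 2 * ⟪ξ, b ξ⟫ =
      gaussVortexProfile ξ * u₀ ξ ^ 2 * ⟪ξ, b ξ⟫ +
        gaussVortexProfile ξ * (u ξ - u₀ ξ) * (u ξ + u₀ ξ) * ⟪ξ, b ξ⟫ := fun ξ => by ring
  have hsplit : ∫ ξ, gaussVortexProfile ξ * u ξ ^ 2 * ⟪ξ, b ξ⟫ =
      ∫ ξ, gaussVortexProfile ξ * (u ξ - u₀ ξ) * (u ξ + u₀ ξ) * ⟪ξ, b ξ⟫ := by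
    rw [integral_congr_ae (Eventually.of_forall hpt), integral_add hzi hri, hzero, zero_add]
  rw [hsplit]
  refine hrle.trans ?_
  have hp_le : 8 * Real.pi * (C_F * C_B) ^ 2 * ∫ ξ, gaussVortexProfile ξ * (u ξ + u₀ ξ) ^ 2 ≤
      32 * Real.pi * (C_F * C_B) ^ 2 * ∫ ξ, gaussVortexProfile ξ * u ξ ^ 2 := by
    have := mul_le_mul_of_nonneg_left hPint (by positivity : (0:ℝ) ≤ 8 * Real.pi * (C_F * C_B) ^ 2)
    linarith
  have hq_le : ∫ ξ, gaussVortexProfile ξ * ((8 * Real.pi)⁻¹ * burgersPhi (‖ξ‖ ^ 2 / 4)) * (u ξ - u₀ ξ) ^ 2 ≤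
      ∫ ξ, gaussVortexProfile ξ * ((8 * Real.pi)⁻¹ * burgersPhi (‖ξ‖ ^ 2 / 4)) * (fderiv ℝ u ξ (perp ξ)) ^ 2 :=
    hW.trans (by linarith)
  calc Real.sqrt (8 * Real.pi * (C_F * C_B) ^ 2 * ∫ ξ, gaussVortexProfile ξ * (u ξ + u₀ ξ) ^ 2) *
        Real.sqrt (∫ ξ, gaussVortexProfile ξ * ((8 * Real.pi)⁻¹ * burgersPhi (‖ξ‖ ^ 2 / 4)) * (u ξ - u₀ ξ) ^ 2)
      ≤ Real.sqrt (32 * Real.pi * (C_F * C_B) ^ 2 * ∫ ξ, gaussVortexProfile ξ * u ξ ^ 2) *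
        Real.sqrt (∫ ξ, gaussVortexProfile ξ * ((8 * Real.pi)⁻¹ * burgersPhi (‖ξ‖ ^ 2 / 4)) *
          (fderiv ℝ u ξ (perp ξ)) ^ 2) :=
        mul_le_mul (Real.sqrt_le_sqrt hp_le) (Real.sqrt_le_sqrt hq_le) (Real.sqrt_nonneg _) (Real.sqrt_nonneg _)
    _ = _ := by rw [Real.sqrt_mul (by positivity)]

end Summit.AnomalousDissipation.AnomalousDissipation.Theorems.MarginalStabilityChainStretchedVortexRows

end
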